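import Mathlib
import HarnessLib
import HarnessLib.Audit
import Summits.ValiantsHypothesis.ValiantsHypothesis.Theorems.LacunarySymmetroidMatrixDescartesWLawNotSharp

/-!
# ValiantsHypothesis / LacunarySymmetroid — crux `MatrixDescartes` (stmt-ValiantsHypothesis-18050, V1), LINE (A) «product_plus_one»:
# zero-change rows of `OneChangeFloorK3` (pen val-idea-25 g9 NOTE §56): `ZeroChangeOnlyNoCrit` and THEOREM 56.2 `TwoRowWKK`

NOTE §56 (pen val-idea-25 g9) scopes the zero-change rows of the stub `OneChangeFloorK3` («P6»): with trinomial rows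
`g = a₀ + a₁X^a + a₂X^c` the floor count of a company is the number of positive critical points of `Φ = ∏ g_j` (§56.1).  The pen's
Sketch `abprobe/s58/card/Sketch-ZC-s58.lean` (97afcd383662b9cb) types the objects `row`, `posCrit` and the statements
`ZeroChangeOnlyNoCrit` (§56.1 (i)) and `TwoRowWKK` (THEOREM 56.2 (a): one W row times one KK row has ≤ 3 positive critical points,
Descartes-sharp at `(a,c) = (2,5)`).  Here: the two objects VERBATIM and BOTH statements PROVED by the pen's texts
(`zeroChangeOnlyNoCrit`, `twoRowWKK`), the second by Mathlib's Descartes rule of signs `Polynomial.roots_countP_pos_le_signVariations`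
applied to the 5-nomial `X·Φ′` (support `{a, 2a, c, a+c, 2c}`, top two coefficients `≥ 0`), via the tree's
`WLawNotSharp.signVariations_le_card_support_of_top_two_nonneg` (`…WLawNotSharp`).

HONEST FRAMING: free-standing helpers about two- and zero-change-free row companies; the open rung `OneRowZeroChange k` and P6 are
NOT touched; no stub of LINE (A) is touched (A40 unchanged, sorries 4 → 4); `MatrixDescartes` OPEN; `VP ≠ VNP` is NOT proved and
nothing here bears on it.
-/

set_option linter.dupNamespace false

namespace Summit.ValiantsHypothesis.ValiantsHypothesis.Theorems.LacunarySymmetroidMatrixDescartes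

namespace ZeroChange

open Polynomial Finset

noncomputable section

/-- A normalised trinomial row with exponents `0 < a < c`.  (pen g9 Sketch text) -/
def row (a c : ℕ) (a₀ a₁ a₂ : ℝ) : ℝ[X] := C a₀ + C a₁ * X ^ a + C a₂ * X ^ c

/-- Number of distinct positive critical points of a real polynomial.  (pen g9 Sketch text) -/
def posCrit (Φ : ℝ[X]) : ℕ := ((derivative Φ).roots.toFinset.filter (fun t => 0 < t)).card

/-! ## Descartes-side bounds -/

/-- `posCrit Φ` is at most the number of positive roots of `X·Φ′` counted with multiplicity. -/
theorem posCrit_le_countP (Φ : ℝ[X]) : posCrit Φ ≤ (X * derivative Φ).roots.countP (fun t => 0 < t) := by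
  rw [posCrit]
  by_cases h0 : derivative Φ = 0
  · simp [h0]
  have h1 : ((derivative Φ).roots.toFinset.filter (fun t => 0 < t)).card ≤
      (derivative Φ).roots.countP (fun t => 0 < t) := by
    rw [← Multiset.toFinset_filter, Multiset.countP_eq_card_filter]
    exact Multiset.toFinset_card_le _
  have h2 : (derivative Φ).roots ≤ (X * derivative Φ).roots := by
    rw [roots_mul (mul_ne_zero X_ne_zero h0)]
    exact Multiset.le_add_left _ _
  exact h1.trans (Multiset.countP_le_of_le _ h2)

/-- Descartes for critical points: `posCrit Φ ≤ signVariations (X·Φ′)`. -/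
theorem posCrit_le_signVariations (Φ : ℝ[X]) : posCrit Φ ≤ (X * derivative Φ).signVariations :=
  (posCrit_le_countP Φ).trans (roots_countP_pos_le_signVariations _)

/-! ## §56.1 (i): zero-change companies have no positive critical point -/

/-- A polynomial with nonnegative coefficients is positive at every `t > 0` unless it is zero. -/
private theorem eval_pos_of_coeff_nonneg {P : ℝ[X]} (hP : P ≠ 0) (h : ∀ n, 0 ≤ P.coeff n) {t : ℝ} (ht : 0 < t) :
    0 < P.eval t := by
  rw [eval_eq_sum_range]
  have hlead : 0 < P.coeff P.natDegree * t ^ P.natDegree :=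
    mul_pos ((h _).lt_of_ne (fun h0 => hP (leadingCoeff_eq_zero.1 h0.symm))) (pow_pos ht _)
  refine lt_of_lt_of_le hlead (single_le_sum (f := fun i => P.coeff i * t ^ i)
    (fun i _ => mul_nonneg (h i) (pow_nonneg ht.le i)) (mem_range.2 (Nat.lt_succ_self _)))

/-- Products of polynomials with nonnegative coefficients have nonnegative coefficients. -/
private theorem coeff_nonneg_mul {P Q : ℝ[X]} (hP : ∀ n, 0 ≤ P.coeff n) (hQ : ∀ n, 0 ≤ Q.coeff n) (n : ℕ) :
    0 ≤ (P * Q).coeff n := by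
  rw [coeff_mul]
  exact sum_nonneg fun x _ => mul_nonneg (hP _) (hQ _)

/-- Finite products of polynomials with nonnegative coefficients have nonnegative coefficients. -/
theorem coeff_nonneg_prod {ι : Type*} (s : Finset ι) (f : ι → ℝ[X]) (h : ∀ i ∈ s, ∀ n, 0 ≤ (f i).coeff n) (n : ℕ) :
    0 ≤ (∏ i ∈ s, f i).coeff n := by
  classical
  induction s using Finset.induction_on generalizing n with
  | empty => rw [prod_empty, coeff_one]; split_ifs <;> norm_num
  | insert a s ha ih =>
    rw [prod_insert ha]
    exact coeff_nonneg_mul (h a (mem_insert_self a s)) (fun m => ih (fun i hi => h i (mem_insert_of_mem hi)) m) n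

/-- A zero-change row has nonnegative coefficients. -/
theorem coeff_row_nonneg {a c : ℕ} {p q s : ℝ} (hp : 0 ≤ p) (hq : 0 ≤ q) (hs : 0 ≤ s) (n : ℕ) :
    0 ≤ (row a c p q s).coeff n := by
  rw [row, coeff_add, coeff_add, coeff_C, coeff_C_mul_X_pow, coeff_C_mul_X_pow]
  split_ifs <;> linarith

/-- **§56.1 (i) — the pen g9 Sketch's `ZeroChangeOnlyNoCrit`, VERBATIM**: a company of zero-change rows only (all coefficients
nonnegative) has no positive critical point. -/
theorem zeroChangeOnlyNoCrit : ∀ (k a c : ℕ), 0 < a → a < c → ∀ (p q s : Fin k → ℝ),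
    (∀ i, 0 < p i ∧ 0 ≤ q i ∧ 0 < s i) →
    posCrit (∏ i, row a c (p i) (q i) (s i)) = 0 := by
  intro k a c _ _ p q s h
  set Φ := ∏ i, row a c (p i) (q i) (s i) with hΦ
  have hcoef : ∀ n, 0 ≤ Φ.coeff n :=
    coeff_nonneg_prod _ _ (fun i _ n => coeff_row_nonneg (h i).1.le (h i).2.1 (h i).2.2.le n)
  have hcoef' : ∀ n, 0 ≤ (derivative Φ).coeff n := fun n => by
    rw [coeff_derivative]; exact mul_nonneg (hcoef _) (by positivity)
  rw [posCrit, Finset.card_eq_zero, Finset.filter_eq_empty_iff]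
  intro t ht hpos
  by_cases h0 : derivative Φ = 0
  · simp [h0] at ht
  · rw [Multiset.mem_toFinset, mem_roots h0, IsRoot.def] at ht
    exact (eval_pos_of_coeff_nonneg h0 hcoef' hpos).ne' ht

/-! ## THEOREM 56.2 (a): one W row times one KK row -/

/-- The 5-nomial `X·(g_W·g_KK)′` (support `{a, 2a, c, a+c, 2c}`). -/
theorem X_mul_derivative_WKK (a c : ℕ) (ha : 0 < a) (hc : 0 < c) (α κ γ p q s : ℝ) :
    X * derivative (row a c (-α) κ γ * row a c p q s) =
      (C ((a : ℝ) * (κ * p - α * q)) * X ^ a + C (2 * (a : ℝ) * (κ * q)) * X ^ (2 * a) +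
        C ((c : ℝ) * (γ * p - α * s)) * X ^ c + C (((a : ℝ) + c) * (κ * s + γ * q)) * X ^ (a + c)) +
      C (2 * (c : ℝ) * (γ * s)) * X ^ (2 * c) := by
  obtain ⟨a', rfl⟩ : ∃ a', a = a' + 1 := ⟨a - 1, by omega⟩
  obtain ⟨c', rfl⟩ : ∃ c', c = c' + 1 := ⟨c - 1, by omega⟩
  simp only [row, derivative_mul, derivative_C, derivative_X_pow, map_mul, map_sub,
    map_add, map_neg, Nat.cast_add, Nat.cast_one, Nat.add_sub_cancel, map_natCast, zero_add, map_ofNat]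
  ring

/-- **THEOREM 56.2 (a) — the pen g9 Sketch's `TwoRowWKK`, VERBATIM** (Descartes-sharp at `(a,c) = (2,5)` per NOTE §56.2): one W row
`(−α, κ, γ)` times one KK row `(p, q, s)` has at most 3 positive critical points. -/
theorem twoRowWKK : ∀ (a c : ℕ), 0 < a → a < c → ∀ (α κ γ p q s : ℝ),
    0 < α → 0 ≤ κ → 0 < γ → 0 < p → 0 ≤ q → 0 < s →
    posCrit (row a c (-α) κ γ * row a c p q s) ≤ 3 := by
  intro a c ha hac α κ γ p q s _ hκ hγ _ hq hs
  have hc : 0 < c := ha.trans hac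
  refine (posCrit_le_signVariations _).trans ?_
  rw [X_mul_derivative_WKK a c ha hc]
  -- the three lower terms
  set R : ℝ[X] := C ((a : ℝ) * (κ * p - α * q)) * X ^ a + C (2 * (a : ℝ) * (κ * q)) * X ^ (2 * a) +
    C ((c : ℝ) * (γ * p - α * s)) * X ^ c with hR
  have hRdeg : R.degree < ((a + c : ℕ) : WithBot ℕ) := by
    have h1 : R.natDegree ≤ c ⊔ (2 * a) := by
      rw [hR]
      refine (natDegree_add_le _ _).trans (max_le ((natDegree_add_le _ _).trans (max_le ?_ ?_)) ?_)
      · exact (natDegree_C_mul_X_pow_le _ _).trans (le_sup_of_le_left hac.le)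
      · exact (natDegree_C_mul_X_pow_le _ _).trans le_sup_right
      · exact (natDegree_C_mul_X_pow_le _ _).trans le_sup_left
    have h2 : R.natDegree < a + c := lt_of_le_of_lt h1 (max_lt (by omega) (by omega))
    exact lt_of_le_of_lt degree_le_natDegree (by exact_mod_cast h2)
  have e : C ((a : ℝ) * (κ * p - α * q)) * X ^ a + C (2 * (a : ℝ) * (κ * q)) * X ^ (2 * a) +
        C ((c : ℝ) * (γ * p - α * s)) * X ^ c + C (((a : ℝ) + c) * (κ * s + γ * q)) * X ^ (a + c) +
      C (2 * (c : ℝ) * (γ * s)) * X ^ (2 * c) =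
      C (2 * (c : ℝ) * (γ * s)) * X ^ (2 * c) + C (((a : ℝ) + c) * (κ * s + γ * q)) * X ^ (a + c) + R := by
    rw [hR]; ring
  rw [e]
  refine (WLawNotSharp.signVariations_le_card_support_of_top_two_nonneg (by positivity) (by positivity)
    (by omega : a + c < 2 * c) hRdeg).trans ?_
  have hsupp : R.support ⊆ {a, 2 * a, c} := by
    rw [hR]
    refine support_add.trans (union_subset (support_add.trans (union_subset ?_ ?_)) ?_)
    · exact (support_C_mul_X_pow_subset _ _).trans (by simp)
    · exact (support_C_mul_X_pow_subset _ _).trans (by simp)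
    · exact (support_C_mul_X_pow_subset _ _).trans (by simp)
  exact (card_le_card hsupp).trans Finset.card_le_three

end

end ZeroChange

end Summit.ValiantsHypothesis.ValiantsHypothesis.Theorems.LacunarySymmetroidMatrixDescartes
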